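import Mathlib
import Summits.ValiantsHypothesis.ValiantsHypothesis.Theses.BarrierLever
import Summits.ValiantsHypothesis.ValiantsHypothesis.Theorems.BarrierLeverChowHitsReadOnceDeterminantsLadder
import Summits.ValiantsHypothesis.ValiantsHypothesis.Theorems.BarrierLeverPartitionMinorsHitByVPOfReadOnce

/-!
# Route BarrierLever — GLUE: item `ChowHitsPartitionMinors` (stmt-ValiantsHypothesis-20172, CPM)
# ⟹ item `PartitionMinorsHitByVP` (stmt-ValiantsHypothesis-19717), and the thin-row slice

Helper file (`--supports stmt-ValiantsHypothesis-19717`; cell valiant-natproofs, rung V4, 𝒟-side of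
door (c); prover seat valiant-natproofs-prover gen 10; planner p1-g14 MAP-next-round §3(b) «glue
`ChowHitsPartitionMinors → PartitionMinorsHitByVP` (size S, ∏ℓ ∈ SmallCircuits ℂ (h+h) 3)»). Closes NO item.

Variables `x_a := X (Fin.castAdd h a)`, `y_c := X (Fin.natAdd h c)` of `MvPolynomial (Fin (h+h)) ℂ`; Nisan's
partition matrix `M_f[u, w] = coeff_{x^u y^w} f`. Item 20172 (CPM) gives, eventually in `h`, for every
square minor `[U, W]` a PRODUCT `∏_k ℓ_k` of `h+h` affine forms with `det M_{∏ℓ}[U, W] ≠ 0`; a product of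
`h+h` forms of degree `≤ 1` in `h+h ≥ 3` variables lies in `SmallCircuits ℂ (h+h) 3`
(`ChowLadder.prod_affine_mem_smallCircuits`: degree `≤ h+h`, size `≤ (h+h)³`), so item 19717 follows with
the size exponent `b = 3`:

* `partitionMinorsHitByVP_of_chowHitsPartitionMinors` — item 20172 ⇒ item 19717 (by name, `b = 3`);
* `partitionMinorsHitByVP_of_chowHitsReadOnceDeterminants` — item 20239 ⇒ item 19717 (by name), through
  the landed `PartitionMinorsOfReadOnce.chowHitsPartitionMinors_of_chowHitsReadOnceDeterminants`
  (item 20239 ⇒ CPM);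
* `chowHitsThinRowPartitionMinors_of_chowHitsPartitionMinors` — item 20172 ⇒ item 20195
  `ChowHitsThinRowPartitionMinors` (CPM restricted to rows of size `≤ 2`; signature verbatim, the route
  file does not render the decl yet);
* `thinRowPartitionMinorsHitByVP_of_chowHitsThinRowPartitionMinors` — item 20195 ⇒ the thin-row slice of
  item 19717 with `b = 3`.

So the live 𝒟-side ladder reads, by name: 20239 ⇒ 20172 ⇒ 19717 and 20172 ⇒ 20195 ⇒ (19717 on thin rows).

WHAT THIS IS NOT: none of 20239 / 20172 / 20195 / 19717 is proved here; nothing on crux stmt-14610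
(FSV Question 6) or `VP` vs `VNP`.

References: [ForbesShpilkaVolk2018] §8 (read-once / rank-method distinguishers); Nisan 1991 (partition
matrices); [Burgisser2000] Rem. 2.7 (circuit-size bookkeeping for products of affine forms).
-/

-- layout Summits/ValiantsHypothesis/ValiantsHypothesis forces the duplicated namespace component
set_option linter.dupNamespace false

namespace Summit.ValiantsHypothesis.ValiantsHypothesis.Theorems.BarrierLever.ChowGlue

open MvPolynomial Literature.Barriers.ValiantsHypothesis

/-- **Item 20172 (CPM) ⇒ item 19717** with size exponent `b = 3`: the product of `h+h` affine forms that
hits the minor is itself a small circuit (`ChowLadder.prod_affine_mem_smallCircuits`, needs `h+h ≥ 3`).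
[cite: ForbesShpilkaVolk2018, §8] -/
theorem partitionMinorsHitByVP_of_chowHitsPartitionMinors
    (H : Theses.BarrierLever.ChowHitsPartitionMinors) :
    Theses.BarrierLever.PartitionMinorsHitByVP := by
  unfold Summit.ValiantsHypothesis.ValiantsHypothesis.Theses.BarrierLever.ChowHitsPartitionMinors at H
  unfold Summit.ValiantsHypothesis.ValiantsHypothesis.Theses.BarrierLever.PartitionMinorsHitByVP
  obtain ⟨h₀, H⟩ := H
  refine ⟨3, max h₀ 2, fun h hh r u w hu hw => ?_⟩
  obtain ⟨ℓ, hℓ, hdet⟩ := H h (le_trans (le_max_left _ _) hh) r u w hu hw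
  have h3 : 3 ≤ h + h := by
    have := le_trans (le_max_right h₀ 2) hh
    omega
  exact ⟨∏ k, ℓ k, ChowLadder.prod_affine_mem_smallCircuits h3 ℓ hℓ, hdet⟩

/-- **Item 20239 ⇒ item 19717** (by name): Chow hits read-once determinants ⇒ CPM
(`PartitionMinorsOfReadOnce.chowHitsPartitionMinors_of_chowHitsReadOnceDeterminants`) ⇒ item 19717.
[cite: ForbesShpilkaVolk2018, §8] -/
theorem partitionMinorsHitByVP_of_chowHitsReadOnceDeterminants
    (H : Theses.BarrierLever.ChowHitsReadOnceDeterminants) :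
    Theses.BarrierLever.PartitionMinorsHitByVP :=
  partitionMinorsHitByVP_of_chowHitsPartitionMinors
    (PartitionMinorsOfReadOnce.chowHitsPartitionMinors_of_chowHitsReadOnceDeterminants H)

/-- **Item 20172 ⇒ item 20195 `ChowHitsThinRowPartitionMinors`** (CPM restricted to rows of size `≤ 2`;
the conclusion is item 20195's signature verbatim): drop the row-size hypothesis. [folklore] -/
theorem chowHitsThinRowPartitionMinors_of_chowHitsPartitionMinors
    (H : Theses.BarrierLever.ChowHitsPartitionMinors) :
    ∃ h₀ : ℕ, ∀ h : ℕ, h₀ ≤ h → ∀ (r : ℕ) (u w : Fin r → Finset (Fin h)),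
      Function.Injective u → Function.Injective w → (∀ i, (u i).card ≤ 2) →
        ∃ ℓ : Fin (h + h) → MvPolynomial (Fin (h + h)) ℂ, (∀ k, (ℓ k).totalDegree ≤ 1) ∧
          (Matrix.of fun i j : Fin r => MvPolynomial.coeff
            (∑ a ∈ u i, Finsupp.single (Fin.castAdd h a) 1 +
              ∑ c ∈ w j, Finsupp.single (Fin.natAdd h c) 1) (∏ k, ℓ k)).det ≠ 0 := by
  unfold Summit.ValiantsHypothesis.ValiantsHypothesis.Theses.BarrierLever.ChowHitsPartitionMinors at H
  obtain ⟨h₀, H⟩ := H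
  exact ⟨h₀, fun h hh r u w hu hw _ => H h hh r u w hu hw⟩

/-- **Item 20195 ⇒ the thin-row slice of item 19717** with `b = 3`: on layouts whose rows have size `≤ 2`
the partition minor is hit by a small circuit (the product of affine forms itself).
[cite: ForbesShpilkaVolk2018, §8] -/
theorem thinRowPartitionMinorsHitByVP_of_chowHitsThinRowPartitionMinors
    (H : ∃ h₀ : ℕ, ∀ h : ℕ, h₀ ≤ h → ∀ (r : ℕ) (u w : Fin r → Finset (Fin h)),
      Function.Injective u → Function.Injective w → (∀ i, (u i).card ≤ 2) →
        ∃ ℓ : Fin (h + h) → MvPolynomial (Fin (h + h)) ℂ, (∀ k, (ℓ k).totalDegree ≤ 1) ∧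
          (Matrix.of fun i j : Fin r => MvPolynomial.coeff
            (∑ a ∈ u i, Finsupp.single (Fin.castAdd h a) 1 +
              ∑ c ∈ w j, Finsupp.single (Fin.natAdd h c) 1) (∏ k, ℓ k)).det ≠ 0) :
    ∃ b h₀ : ℕ, ∀ h : ℕ, h₀ ≤ h → ∀ (r : ℕ) (u w : Fin r → Finset (Fin h)),
      Function.Injective u → Function.Injective w → (∀ i, (u i).card ≤ 2) →
        ∃ f ∈ SmallCircuits ℂ (h + h) b,
          (Matrix.of fun i j : Fin r => MvPolynomial.coeff
            (∑ a ∈ u i, Finsupp.single (Fin.castAdd h a) 1 +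
              ∑ c ∈ w j, Finsupp.single (Fin.natAdd h c) 1) f).det ≠ 0 := by
  obtain ⟨h₀, H⟩ := H
  refine ⟨3, max h₀ 2, fun h hh r u w hu hw hthin => ?_⟩
  obtain ⟨ℓ, hℓ, hdet⟩ := H h (le_trans (le_max_left _ _) hh) r u w hu hw hthin
  have h3 : 3 ≤ h + h := by
    have := le_trans (le_max_right h₀ 2) hh
    omega
  exact ⟨∏ k, ℓ k, ChowLadder.prod_affine_mem_smallCircuits h3 ℓ hℓ, hdet⟩

end Summit.ValiantsHypothesis.ValiantsHypothesis.Theorems.BarrierLever.ChowGlue
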